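import Mathlib
import Summits.KontsevichZagierPeriods.Zeta5Search.Families.BasicGrowthDuality
import Summits.KontsevichZagierPeriods.Zeta5Search.Families.BasicGrowthMaximum
import Summits.KontsevichZagierPeriods.Zeta5Search.Families.BasicGrowthHalfPow
import Summits.KontsevichZagierPeriods.Zeta5Search.Families.ConvergentSymmetries
import Summits.KontsevichZagierPeriods.Zeta5Search.Families.ExactDualityBZ
import HarnessLib

/-!
# ζ(5) search — Families: the duality EXTREMA — attained, separated by `4^{n−2}`, and Brown–Zudilin's cubic

HONEST FRAMING: systematic search; no irrationality claim unless certified.  STRUCTURAL facts about the size of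
Brown's basic cellular integrals [Brown2016, §1.5 (1.3)–(1.4)] (seat P2, Families layer); nothing about the
arithmetic of any zeta value.

`Families/BasicGrowthDuality.lean` proved `M_σ = sup_{X_δ} F_σ` and `1/M_{σ⁻¹} = inf_{X_σ} F_σ` for the projective
Brown function `F_σ` (`Families/BasicGrowthProjective.lean`).  Here:
* `exists_FSigma_eq_inv_fSup`, **`isLeast_FSigma_dualCell`** — for CONVERGENT `σ⁻¹` the infimum over the dual cell
  `X_σ` is a MINIMUM (transport of the maximiser of `f_{σ⁻¹}`, `Families/BasicGrowthMaximum`);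
  **`isGreatest_FSigma_stdCell`** — for convergent `σ` the supremum over `X_δ` is a maximum;
* `convergent_of_inverse`, **`fSup_mul_fSup_inverse_le`** (`M_σ · M_{σ⁻¹} ≤ 4^{−(n−2)}`, from
  `Families/BasicGrowthHalfPow` and the duality-invariance of convergence `Families/ConvergentSymmetries`),
  **`FSigma_stdCell_mul_le_dualCell`** — Brown's function SEPARATES the two cells: `4^{n−2} · F_σ(z) ≤ F_σ(z')` for
  `z ∈ X_δ`, `z' ∈ X_σ` (convergent `σ`, `n ≥ 4`);
* **`isLeast_FSigma_pi8dual_dualCell`** / `isGreatest_FSigma_pi8dual_stdCell` /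
  `exists_roots_isGreatest_isLeast_pi8dual` — for the Brown–Zudilin configuration `₈π₈^∨ = pi8dual`: the LARGEST root
  `λ₃ = 592.0793805…` of `χ(λ) = 4λ³ − 2368λ² − 188λ + 1` [BrownZudilin2022, §2] (in print the growth rate of the
  leading coefficients `Q_n`; named fact `BrownZudilin2022.rates`, NOT used) is the MINIMUM of `F_{₈π₈^∨}` over the
  real configurations seated in the order `₈π₈^∨`, and the smallest root `λ₁ = 0.0050037…` (the decay rate of the
  integrals, `Families/BasicGrowthEightExact`) is its MAXIMUM over the configurations in the standard order —
  combining `Families/ExactDualityBZ` (`M_{₈π₈}·λ₃ = 1`) with the duality theorem.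
Standard axioms only (`decide` for the convergence of the two plans on `Fin 8`).
-/

noncomputable section

open Finset Set
open Literature.NumberTheory.Irrationality

namespace Summit.KontsevichZagierPeriods.Zeta5Search.Families.Cellular

variable {ℓ : ℕ} (σ : Fin (ℓ + 3) → Fin (ℓ + 3))

/-! ### The infimum over the dual cell is attained; the Brown–Zudilin pair -/

/-- **The infimum over the dual cell is a MINIMUM** when the dual seating `τ = σ⁻¹` is convergent: the maximiser `t*`
of `f_τ` (`Families/BasicGrowthMaximum`) gives the configuration `zOf t* ∘ τ ∈ X_σ` with `F_σ = 1/M_τ`. -/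
theorem exists_FSigma_eq_inv_fSup {σ τ : Fin (ℓ + 3) → Fin (ℓ + 3)} (hστ : ∀ i, σ (τ i) = i)
    (hτσ : ∀ i, τ (σ i) = i) (hc : Convergent τ) :
    ∃ z : Fin (ℓ + 3) → ℝ, StrictMono (z ∘ σ) ∧ FSigma σ z = (fSup τ)⁻¹ := by
  have hτ := bijective_of_inverse hστ hτσ
  obtain ⟨t, ht, heq⟩ := exists_fSigma_eq_fSup τ hτ hc
  refine ⟨zOf t ∘ τ, ?_, ?_⟩
  · have e : (zOf t ∘ τ) ∘ σ = zOf t := funext fun k => congrArg (zOf t) (hτσ k)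
    rw [e]
    exact zOf_strictMono ht
  · rw [FSigma_dual hτσ, ← fSigma_eq_FSigma_zOf τ hτ ht, heq]

/-- `1/M_{σ⁻¹}` is the LEAST value of `F_σ` on the dual cell (convergent `σ⁻¹`). -/
theorem isLeast_FSigma_dualCell {σ τ : Fin (ℓ + 3) → Fin (ℓ + 3)} (hστ : ∀ i, σ (τ i) = i)
    (hτσ : ∀ i, τ (σ i) = i) (hc : Convergent τ) :
    IsLeast (FSigma σ '' {z : Fin (ℓ + 3) → ℝ | StrictMono (z ∘ σ)}) (fSup τ)⁻¹ := by
  obtain ⟨z, hz, heq⟩ := exists_FSigma_eq_inv_fSup hστ hτσ hc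
  exact ⟨⟨z, hz, heq⟩, by rintro _ ⟨z', hz', rfl⟩; exact inv_fSup_le_FSigma hστ hτσ hz'⟩

/-- `M_σ` is the GREATEST value of `F_σ` on the standard cell (convergent `σ`). -/
theorem isGreatest_FSigma_stdCell (hσ : Function.Bijective σ) (hc : Convergent σ) :
    IsGreatest (FSigma σ '' {z : Fin (ℓ + 3) → ℝ | StrictMono z}) (fSup σ) := by
  obtain ⟨t, ht, heq⟩ := exists_fSigma_eq_fSup σ hσ hc
  exact ⟨⟨zOf t, zOf_strictMono ht, by rw [← fSigma_eq_FSigma_zOf σ hσ ht, heq]⟩,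
    by rintro _ ⟨z, hz, rfl⟩; exact FSigma_le_fSup σ hσ hz⟩

/-- `₈π₈ = pi8dualInv` is a convergent seating. -/
theorem convergent_pi8dualInv : Convergent pi8dualInv := by decide

/-- `₈π₈^∨ = pi8dual` is a convergent seating. -/
theorem convergent_pi8dual' : Convergent pi8dual := by decide

/-- **Brown–Zudilin's cubic, geometrically.**  For the configuration `₈π₈^∨` the LARGEST root
`λ₃ ∈ (592.0793805, 592.0793806)` of `χ(λ) = 4λ³ − 2368λ² − 188λ + 1` [BrownZudilin2022, §2] is the MINIMUM of Brown's
function `F_{₈π₈^∨}` over the real configurations seated in the order `₈π₈^∨` (the dual cell), while the smallest root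
`λ₁` is its MAXIMUM over the configurations in the standard order (`Families/BasicGrowthEightExact`):
`min_{X_{₈π₈^∨}} F_{₈π₈^∨} = λ₃`. -/
theorem isLeast_FSigma_pi8dual_dualCell {lam : ℝ} (hχ : BrownZudilin2022.charPoly lam = 0)
    (h1 : (5920793805 : ℝ) / 10 ^ 7 < lam) (h2 : lam < (5920793806 : ℝ) / 10 ^ 7) :
    IsLeast (FSigma pi8dual '' {z : Fin 8 → ℝ | StrictMono (z ∘ pi8dual)}) lam := by
  have h := fSup_pi8dualInv_mul_eq_one_of_charPoly hχ h1 h2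
  have hl : (fSup pi8dualInv)⁻¹ = lam :=
    (eq_inv_of_mul_eq_one_right h).symm
  rw [← hl]
  exact isLeast_FSigma_dualCell pi8dual_pi8dualInv pi8dualInv_pi8dual convergent_pi8dualInv

/-- `max_{X_δ} F_{₈π₈^∨} = λ₁`, the smallest root of `χ` (bracket `(0.005003781, 0.005003782)`). -/
theorem isGreatest_FSigma_pi8dual_stdCell {lam : ℝ} (hχ : BrownZudilin2022.charPoly lam = 0)
    (h1 : (5003781 : ℝ) / 10 ^ 9 < lam) (h2 : lam < (5003782 : ℝ) / 10 ^ 9) :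
    IsGreatest (FSigma pi8dual '' {z : Fin 8 → ℝ | StrictMono z}) lam := by
  rw [← fSup_pi8dual_eq_of_charPoly hχ h1 h2]
  exact isGreatest_FSigma_stdCell pi8dual pi8dual_bijective convergent_pi8dual'

/-- **The two extreme roots of `χ` are the two extreme values of ONE function**: there are roots `λ₁ < λ₃` of
Brown–Zudilin's cubic with `λ₁ = max_{X_δ} F_{₈π₈^∨}` and `λ₃ = min_{X_{₈π₈^∨}} F_{₈π₈^∨}`. -/
theorem exists_roots_isGreatest_isLeast_pi8dual :
    ∃ lam1 lam3 : ℝ, BrownZudilin2022.charPoly lam1 = 0 ∧ BrownZudilin2022.charPoly lam3 = 0 ∧ lam1 < lam3 ∧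
      IsGreatest (FSigma pi8dual '' {z : Fin 8 → ℝ | StrictMono z}) lam1 ∧
      IsLeast (FSigma pi8dual '' {z : Fin 8 → ℝ | StrictMono (z ∘ pi8dual)}) lam3 := by
  obtain ⟨lam1, hm1, hχ1⟩ := BrownZudilin2022.charPoly_roots.1
  obtain ⟨lam3, hm3, hχ3⟩ := BrownZudilin2022.charPoly_roots.2.2
  refine ⟨lam1, lam3, hχ1, hχ3, ?_, isGreatest_FSigma_pi8dual_stdCell hχ1 hm1.1 hm1.2,
    isLeast_FSigma_pi8dual_dualCell hχ3 hm3.1 hm3.2⟩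
  have := hm1.2
  have := hm3.1
  norm_num at *
  linarith

/-! ### The two cells are separated by the factor `4^{n−2}` -/

/-- The inverse of a convergent seating is convergent (function form of `convergent_symm_iff`). -/
theorem convergent_of_inverse {σ τ : Fin (ℓ + 3) → Fin (ℓ + 3)} (hστ : ∀ i, σ (τ i) = i) (hτσ : ∀ i, τ (σ i) = i)
    (hc : Convergent σ) : Convergent τ :=
  (convergent_symm_iff (⟨σ, τ, hτσ, hστ⟩ : Equiv.Perm (Fin (ℓ + 3)))).2 hc

/-- **`M_σ · M_{σ⁻¹} ≤ 4^{−(n−2)}`** for every convergent seating on `n = ℓ + 3 ≥ 4` points (both growth constants are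
`≤ 2^{−(n−2)}`, `Families/BasicGrowthHalfPow`; the inverse is convergent too). -/
theorem fSup_mul_fSup_inverse_le {σ τ : Fin (ℓ + 3) → Fin (ℓ + 3)} (hστ : ∀ i, σ (τ i) = i) (hτσ : ∀ i, τ (σ i) = i)
    (hc : Convergent σ) (hℓ : 1 ≤ ℓ) : fSup σ * fSup τ ≤ (1 / 4) ^ (ℓ + 1) := by
  have hσ : Function.Bijective σ := bijective_of_inverse hτσ hστ
  have hτ := bijective_of_inverse hστ hτσ
  have h1 := fSup_le_half_pow σ hσ hc hℓ
  have h2 := fSup_le_half_pow τ hτ (convergent_of_inverse hστ hτσ hc) hℓ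
  calc fSup σ * fSup τ ≤ (1 / 2) ^ (ℓ + 1) * (1 / 2) ^ (ℓ + 1) :=
        mul_le_mul h1 h2 (fSup_pos τ hτ).le (by positivity)
    _ = (1 / 4) ^ (ℓ + 1) := by rw [← mul_pow]; norm_num

/-- **Brown's function separates the standard cell from the dual cell by the factor `4^{n−2}`**: for a convergent
seating `σ` (`n ≥ 4`), every value of `F_σ` on `X_δ` (`≤ M_σ ≤ 2^{−(n−2)}`) times `4^{n−2}` is still at most every value
of `F_σ` on `X_σ` (`≥ 1/M_{σ⁻¹} ≥ 2^{n−2}`). -/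
theorem FSigma_stdCell_mul_le_dualCell {σ τ : Fin (ℓ + 3) → Fin (ℓ + 3)} (hστ : ∀ i, σ (τ i) = i)
    (hτσ : ∀ i, τ (σ i) = i) (hc : Convergent σ) (hℓ : 1 ≤ ℓ) {z z' : Fin (ℓ + 3) → ℝ} (hz : StrictMono z)
    (hz' : StrictMono (z' ∘ σ)) : FSigma σ z * 4 ^ (ℓ + 1) ≤ FSigma σ z' := by
  have hσ : Function.Bijective σ := bijective_of_inverse hτσ hστ
  have hτ := bijective_of_inverse hστ hτσ
  have a : FSigma σ z ≤ (1 / 2) ^ (ℓ + 1) := (FSigma_le_fSup σ hσ hz).trans (fSup_le_half_pow σ hσ hc hℓ)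
  have b : (2 : ℝ) ^ (ℓ + 1) ≤ FSigma σ z' := by
    have h2 := fSup_le_half_pow τ hτ (convergent_of_inverse hστ hτσ hc) hℓ
    have h3 : (2 : ℝ) ^ (ℓ + 1) ≤ (fSup τ)⁻¹ := by
      rw [show (2 : ℝ) ^ (ℓ + 1) = ((1 / 2) ^ (ℓ + 1))⁻¹ by rw [one_div, inv_pow, inv_inv]]
      exact inv_anti₀ (fSup_pos τ hτ) h2
    exact h3.trans (inv_fSup_le_FSigma hστ hτσ hz')
  calc FSigma σ z * 4 ^ (ℓ + 1) ≤ (1 / 2) ^ (ℓ + 1) * 4 ^ (ℓ + 1) := mul_le_mul_of_nonneg_right a (by positivity)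
    _ = (2 : ℝ) ^ (ℓ + 1) := by rw [← mul_pow]; norm_num
    _ ≤ FSigma σ z' := b

end Summit.KontsevichZagierPeriods.Zeta5Search.Families.Cellular
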